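import Summits.BirchSwinnertonDyer.BirchSwinnertonDyer.Theorems.UniversalToricDescentTameQuotientSurjective
import Summits.BirchSwinnertonDyer.BirchSwinnertonDyer.Theorems.UniversalToricDescentAdditiveLocalTerm
import Literature.NumberTheory.GaloisRepresentations.TameInertiaCharacterProofs
import HarnessLib

/-!
# Route UniversalToricDescent — the inertia group of an `ℓ`-adic field (`ℓ ≠ p`): `#H¹(I_F, B) = #B^{I_F}` for
# FINITE `p`-primary `B`, and `H¹(I_F, A)` is `p`-DIVISIBLE for a `p`-divisible `A` with finite layers

Lead prover bsd-wall-utd-p1 g10 (`--supports stmt-BirchSwinnertonDyer-20399`; the two structural halves of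
Greenberg–Vatsal's Prop. (2.4) on the inertia side, for the local field itself). `F` a non-archimedean local
field of characteristic `0`, residue characteristic `ℓ ≠ p`, `I_F = absInertia F`, `J ⊴ I_F` the
prime-to-`p` kernel (`UniversalToricDescentInertiaPrimeToP`), `τ` a tame `p`-generator:

* `exists_index_dvd_of_coprime_index` — **`I_F/J` is infinitely `p`-divisible**: for every `e` there is an
  open normal `U ⊴ I_F` with `pᵉ ∣ [I_F : J U]` (the Kummer character of level `pᵉ` of a uniformiser is a
  continuous homomorphism onto a group containing an element of order `pᵉ`, trivial on the pro-`p′`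
  subgroup `J`).
* `natCard_continuousCohomology_one_absInertia_eq_natCard_invariants` — **`#H¹(I_F, B) = #B^{I_F}`** for a
  FINITE discrete `p`-primary `Γ_F`-module `B`: the classical EQUALITY (Serre *Local Fields* XIII §1,
  Milne *ADT* I 2.8) behind the tree's inequality `natCard_continuousCohomology_one_absInertia_le_natCard_invariants`.
* `exists_nsmul_eq_continuousCohomology_one_absInertia` — **`H¹(I_F, A)` is `p`-divisible** for a discrete
  `p`-primary `p`-divisible `A` with finite layers (e.g. `E[p^∞]` at any place `v ∤ p`): the `μ = 0` /
  cofreeness half of Greenberg–Vatsal's `H¹(I_ℓ, A) ≅ (A^{J_ℓ})_{τ}(−1)`.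

Assembly of `UniversalToricDescentTameQuotientEvaluation` / `…Surjective` (abstract `G = cl⟨N, τ⟩`) with the
structure of `I_F` (`…InertiaPrimeToP`, the tame generator of `TameInertiaCoinvariantsEvaluationProofs`, and the
Kummer characters of `TameInertiaCharacterProofs`).

THEOREMS ONLY; no definition, no named fact, no `sorry`. BSD is not advanced by this file.
References: [GreenbergVatsal2000] §2, proof of Prop. (2.4) (arXiv p. 22); [SerreLocalFields1979] Ch. XIII §1
Prop. 1, Ch. IV §2; [MilneADT2006] I §2 Lemma 2.9; [SerreInventiones1972] §1.3 Prop. 2.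
-/

set_option autoImplicit false
-- `…BirchSwinnertonDyer.BirchSwinnertonDyer.Theorems…` is the problem's mandated namespace (D-0017).
set_option linter.dupNamespace false

noncomputable section

open scoped Classical Pointwise Valued IntermediateField
open Field ValuativeRel

namespace Summit.BirchSwinnertonDyer.BirchSwinnertonDyer.Theorems.UniversalToricDescentInertiaH1Structure

open Literature.NumberTheory.GaloisRepresentations
  Literature.NumberTheory.GaloisRepresentations.IsNonarchimedeanLocalField Function Topology ContinuousCohomology
  Summit.BirchSwinnertonDyer.BirchSwinnertonDyer.Theorems.UniversalToricDescentInertiaPrimeToP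
  Summit.BirchSwinnertonDyer.BirchSwinnertonDyer.Theorems.UniversalToricDescentTameQuotientEvaluation
  Summit.BirchSwinnertonDyer.BirchSwinnertonDyer.Theorems.UniversalToricDescentTameQuotientSurjective
  Summit.BirchSwinnertonDyer.BirchSwinnertonDyer.Theorems.UniversalToricDescentAdditiveLocalTerm

variable (F : Type) [Field F] [ValuativeRel F] [TopologicalSpace F] [IsNonarchimedeanLocalField F]
  [CharZero F] {p : ℕ} [hp : Fact p.Prime]

/-! ### §1 `I_F/J` is infinitely `p`-divisible -/

omit [CharZero F] in
/-- **For a pro-prime-to-`p` subgroup `J ≤ I_F` and every `e`, some open normal `U ⊴ I_F` has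
`pᵉ ∣ [I_F : J U]`**: `U` = the kernel of the Kummer character `θ_{pᵉ}` of a uniformiser (open; `θ` reaches
a primitive `pᵉ`-th root of unity, and is trivial on `J`, whose image is a `p`-group of order prime to `p`).
[cite: SerreInventiones1972, §1.3 Prop. 2] [cite: SerreLocalFields1979, Ch. IV §2] -/
theorem exists_index_dvd_of_coprime_index (hℓ : ringChar 𝓀[F] ≠ p) (J : Subgroup (absInertia F))
    (hcopJ : ∀ U : Subgroup J, U.Normal → IsOpen (U : Set J) → U.index.Coprime p) (e : ℕ) :
    ∃ U : Subgroup (absInertia F), U.Normal ∧ IsOpen (U : Set (absInertia F)) ∧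
      p ^ e ∣ (J ⊔ U).index := by
  haveI : CompactSpace (absoluteGaloisGroup F) := absoluteGaloisGroup_compactSpace F
  have hIcl : IsClosed (absInertia F : Set (absoluteGaloisGroup F)) := isClosed_absInertia_holds F
  haveI : CompactSpace (absInertia F) := isCompact_iff_compactSpace.mp hIcl.isCompact
  -- the Kummer character of level `p^e`
  letI : Field (absIntegers 𝒪[F] F ⧸ absMaximalIdeal F) := Ideal.Quotient.field _
  obtain ⟨ϖ, hϖ⟩ := IsDiscreteValuationRing.exists_irreducible 𝒪[F]
  have hd : 0 < p ^ e := pow_pos hp.out.pos _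
  have hpd : ¬ ringChar 𝓀[F] ∣ p ^ e := fun h ↦
    hℓ ((Nat.prime_dvd_prime_iff_eq (ringChar_residueField_prime (F := F)) hp.out).mp
      ((ringChar_residueField_prime (F := F)).dvd_of_dvd_pow h))
  set θ := kummerCharacter F hd hϖ.ne_zero (RingHom.id (absIntegers 𝒪[F] F ⧸ absMaximalIdeal F))
    with hθdef
  -- `ker θ` is open
  set zr : AlgebraicClosure F := (kummerRoot F hd ϖ : AlgebraicClosure F) with hzrdef
  have hzi : IsIntegral F zr := IsIntegral.of_pow hd (by
    rw [hzrdef, coe_kummerRoot_pow F hd ϖ, IsScalarTower.algebraMap_apply 𝒪[F] F (AlgebraicClosure F)]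
    exact isIntegral_algebraMap)
  haveI : FiniteDimensional F F⟮zr⟯ := IntermediateField.adjoin.finiteDimensional hzi
  have hkerOpen : IsOpen (θ.ker : Set ↥(absInertia F)) := by
    refine Subgroup.isOpen_of_mem_nhds (g := 1) _ (mem_nhds_iff.2
      ⟨Subtype.val ⁻¹' {γ | absoluteGaloisGroup.toAlgEquiv F γ ∈ F⟮zr⟯.fixingSubgroup}, fun σ hσ ↦ ?_,
        (IntermediateField.fixingSubgroup_isOpen F⟮zr⟯).preimage continuous_subtype_val, ?_⟩)
    · refine MonoidHom.mem_ker.mpr (kummerCharacter_eq_one_of_smul_eq hd hϖ.ne_zero _ σ ?_)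
      rw [absoluteGaloisGroup.smul_def]
      exact (IntermediateField.mem_fixingSubgroup_iff _ _).mp hσ zr
        (IntermediateField.mem_adjoin_simple_self F zr)
    · change absoluteGaloisGroup.toAlgEquiv F ((1 : ↥(absInertia F)) : absoluteGaloisGroup F) ∈
        F⟮zr⟯.fixingSubgroup
      rw [OneMemClass.coe_one, map_one]; exact Subgroup.one_mem _
  haveI : Finite (absInertia F ⧸ θ.ker) := Subgroup.quotient_finite_of_isOpen _ hkerOpen
  haveI : Finite θ.range :=
    Nat.finite_of_card_ne_zero (by rw [← Subgroup.index_ker]; exact Subgroup.index_ne_zero_of_finite)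
  -- `θ` is trivial on `J`
  have hJker : J ≤ θ.ker := by
    intro x hx
    let θJ : J →* _ := θ.comp J.subtype
    have hkerJ : IsOpen (θJ.ker : Set J) := by
      have : (θJ.ker : Set J) = Subtype.val ⁻¹' (θ.ker : Set (absInertia F)) := by
        ext y; simp [θJ, MonoidHom.mem_ker]
      rw [this]
      exact hkerOpen.preimage continuous_subtype_val
    have hcop := hcopJ θJ.ker inferInstance hkerJ
    rw [Subgroup.index_ker] at hcop
    -- the range of `θJ` is a `p`-group, of order prime to `p`: trivial
    have hle : θJ.range ≤ θ.range := by
      rintro _ ⟨z, rfl⟩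
      exact ⟨(z : absInertia F), rfl⟩
    haveI : Finite θJ.range := Finite.of_injective _ (Subgroup.inclusion_injective hle)
    have hPG : IsPGroup p θJ.range := fun y ↦ ⟨e, Subtype.ext (by
      obtain ⟨z, hz⟩ := y.2
      rw [SubmonoidClass.coe_pow, ← hz, OneMemClass.coe_one]
      exact kummerCharacter_pow_eq_one hd hϖ.ne_zero _ _)⟩
    obtain ⟨a, ha⟩ := hPG.exists_card_eq
    rw [ha] at hcop
    have ha0 : a = 0 := by
      by_contra h
      have : p ∣ Nat.gcd (p ^ a) p := Nat.dvd_gcd (dvd_pow_self p h) dvd_rfl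
      rw [hcop] at this
      exact hp.out.one_lt.ne' (Nat.dvd_one.mp this)
    rw [ha0, pow_zero] at ha
    haveI : Subsingleton θJ.range := (Nat.card_eq_one_iff_unique.mp ha).1
    have hmem : θ x ∈ θJ.range := ⟨⟨x, hx⟩, rfl⟩
    have h1 : (⟨θ x, hmem⟩ : θJ.range) = 1 := Subsingleton.elim _ _
    exact MonoidHom.mem_ker.mpr (congrArg Subtype.val h1)
  -- `p^e ∣ #range θ = [I_F : ker θ]`
  refine ⟨θ.ker, inferInstance, hkerOpen, ?_⟩
  rw [sup_eq_right.mpr hJker, Subgroup.index_ker]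
  obtain ⟨σ₁, hσ₁⟩ := exists_isPrimitiveRoot_kummerCharacter
    (RingHom.id (absIntegers 𝒪[F] F ⧸ absMaximalIdeal F)) hd hpd hϖ
  have horder : orderOf (⟨θ σ₁, ⟨σ₁, rfl⟩⟩ : θ.range) = p ^ e := by
    rw [← Subgroup.orderOf_coe]
    exact hσ₁.eq_orderOf.symm
  rw [← horder]
  exact orderOf_dvd_natCard _

/-! ### §2 `#H¹(I_F, B) = #B^{I_F}` and the divisibility of `H¹(I_F, A)` -/

variable {A : Type} [AddCommGroup A] [TopologicalSpace A] [DiscreteTopology A]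

/-- **`#H¹(I_F, B) = #B^{I_F}`** for a FINITE discrete `p`-primary `Γ_F`-module `B` (`F` char-`0` local,
residue characteristic `≠ p`): `H¹(I_F, B) ≅ (B^J)/(τ − 1)(B^J)` and `#(B^J)/(τ−1) = #(B^J)^τ = #B^{I_F}`.
The classical equality of which the tree's `natCard_continuousCohomology_one_absInertia_le_natCard_invariants`
is the inequality. [cite: SerreLocalFields1979, Ch. XIII §1 Prop. 1 and Ch. IV §2 Cor. 1, Cor. 3 of Prop. 7]
[cite: MilneADT2006, I §2 Lemma 2.9 and proof of Thm. 2.8] -/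
theorem natCard_continuousCohomology_one_absInertia_eq_natCard_invariants [Finite A]
    (hℓ : ringChar 𝓀[F] ≠ p) (ρ : ContinuousRep (absoluteGaloisGroup F) ℤ A)
    (hA : ∀ a : A, ∃ k : ℕ, p ^ k • a = 0) :
    Nat.card (continuousCohomology 1
        ((ρ.restrict (Literature.NumberTheory.GaloisRepresentations.subgroupIncl (absInertia F))).toTopRep)) =
      Nat.card {a : A // ∀ σ ∈ absInertia F, ρ σ a = a} := by
  haveI : CompactSpace (absoluteGaloisGroup F) := absoluteGaloisGroup_compactSpace F
  haveI : TotallyDisconnectedSpace (absoluteGaloisGroup F) := by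
    change TotallyDisconnectedSpace (AlgebraicClosure F ≃ₐ[F] AlgebraicClosure F); infer_instance
  have hIcl : IsClosed (absInertia F : Set (absoluteGaloisGroup F)) := isClosed_absInertia_holds F
  haveI : CompactSpace (absInertia F) := isCompact_iff_compactSpace.mp hIcl.isCompact
  obtain ⟨τ, hgen, -, -⟩ := exists_tame_generator_continuousCohomology_absInertia F (p := p) hℓ
  obtain ⟨J, hJn, hJc, hJcop, hJgen⟩ := exists_proPrimeToP_normal_absInertia F hℓ τ hgen
  haveI := hJn
  rw [natCard_continuousCohomology_one_eq_natCard_invariants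
    (ρ.restrict (Literature.NumberTheory.GaloisRepresentations.subgroupIncl (absInertia F))) hp.out hA J
    hJc hJcop τ (forall_exists_pow_of_forall_exists_zpow J τ hJgen)
    (exists_index_dvd_of_coprime_index F hℓ J hJcop)]
  exact Nat.card_congr (Equiv.subtypeEquivRight fun a ↦
    ⟨fun h σ hσ ↦ h ⟨σ, hσ⟩, fun h g ↦ h g g.2⟩)

/-- **`H¹(I_F, A)` is `p`-divisible** for a discrete `p`-primary `p`-divisible `Γ_F`-module `A` with finite
layers `A[p^k]` (`F` char-`0` local, residue characteristic `≠ p`; e.g. `A = E[p^∞]` at a place `v ∤ p`):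
every class is `p` times a class. With `#H¹(I_F, A)[p]` finite this is the cofreeness
`H¹(I_ℓ, A) ≅ (ℚ_p/ℤ_p)^r` of Greenberg–Vatsal's Prop. (2.4) on the inertia side.
[cite: GreenbergVatsal2000, §2, proof of Prop. (2.4) (arXiv p. 22)] [cite: SerreLocalFields1979, Ch. XIII §1 Prop. 1] -/
theorem exists_nsmul_eq_continuousCohomology_one_absInertia (hℓ : ringChar 𝓀[F] ≠ p)
    (ρ : ContinuousRep (absoluteGaloisGroup F) ℤ A) (hA : ∀ a : A, ∃ k : ℕ, p ^ k • a = 0)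
    (hdiv : ∀ a : A, ∃ b : A, p • b = a) (hfin : ∀ k : ℕ, Set.Finite {a : A | p ^ k • a = 0})
    (x : continuousCohomology 1
      ((ρ.restrict (Literature.NumberTheory.GaloisRepresentations.subgroupIncl (absInertia F))).toTopRep)) :
    ∃ y : continuousCohomology 1
      ((ρ.restrict (Literature.NumberTheory.GaloisRepresentations.subgroupIncl (absInertia F))).toTopRep),
      p • y = x := by
  haveI : CompactSpace (absoluteGaloisGroup F) := absoluteGaloisGroup_compactSpace F
  haveI : TotallyDisconnectedSpace (absoluteGaloisGroup F) := by
    change TotallyDisconnectedSpace (AlgebraicClosure F ≃ₐ[F] AlgebraicClosure F); infer_instance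
  have hIcl : IsClosed (absInertia F : Set (absoluteGaloisGroup F)) := isClosed_absInertia_holds F
  haveI : CompactSpace (absInertia F) := isCompact_iff_compactSpace.mp hIcl.isCompact
  obtain ⟨τ, hgen, -, -⟩ := exists_tame_generator_continuousCohomology_absInertia F (p := p) hℓ
  obtain ⟨J, hJn, hJc, hJcop, hJgen⟩ := exists_proPrimeToP_normal_absInertia F hℓ τ hgen
  haveI := hJn
  exact exists_nsmul_eq_of_divisible
    (ρ.restrict (Literature.NumberTheory.GaloisRepresentations.subgroupIncl (absInertia F))) hp.out hA hdiv
    hfin J hJc hJcop τ (forall_exists_pow_of_forall_exists_zpow J τ hJgen)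
    (exists_index_dvd_of_coprime_index F hℓ J hJcop) x

end Summit.BirchSwinnertonDyer.BirchSwinnertonDyer.Theorems.UniversalToricDescentInertiaH1Structure

end
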